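import Literature.Probability.FitznerVanDerHofstad2017.PosExpr
import Literature.Probability.FitznerVanDerHofstad2017.NoGoFrame
import Mathlib.Data.Fin.VecNotation

/-!
# Literature.Probability.FitznerVanDerHofstad2017.Stage1Cells — `Percolation.nb` cells 3–43 as positive expressions

CITATION HEADER (PLACEMENT v2). Part of the certified REPRODUCTION of R. Fitzner, R. van der Hofstad, *Mean-field
behavior for nearest-neighbor percolation in d > 10*, EJP 22 (2017) no. 43 [FvdH17] (notebook `Percolation.nb`,
transcript HOME/b2b-lace-num3/published/Percolation.txt, auto-port HOME/num1/engineA/Percolation.auto.py) and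
*Generalized approach to the non-backtracking lace expansion*, PTRF 169 (2017) 1041–1119 [NoBLE17]; build `lace`,
seat lean1 (gen 4), node N28 / GAPS G19 (1) / REFEREE R38.3.

What this module is.  STAGE 1 of the NoBLE percolation bound map — the bounds on the simple-random-walk and
non-backtracking two-point functions (cells 3–10), the repulsive bubbles / triangles / squares and their open and
weighted versions (cells 11–15), the matrices `A, A^ι, Ā^ι, B, B̄, C₁, C₂, C₃, H₁, H₂, H₃` and vectors `P^S, P^E, P^ι,
h^S, h^E, h^ι, h^{ιι}` of [FvdH17] §§4–5 (cells 16–31), and the bounds on the NoBLE coefficients `Ξ^{(N)}, Ξ^{ι,(N)},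
Ψ^{(N)}, Π^{(N)}` for `N = 0, 1, 2, 3` and their differences (cells 33–40, 43) — transcribed AS CODED (HOME/DIVERGENCE.md:
the `OpenTriangle` product D12, `Matrix[ANonRep] = Table[Bound[A,…]]` D16, the literal `10`s of `OpenSquare` D26, the
class substitutions of cell 15 D15) into the syntax `PX Atom TKey` of `PosExpr.lean`, generically in the parameters
`(d, ComputedSteps, MaxNumberOfSteps)` and over abstract SRW tables, in the TAIL-FREE variant `T″₀` of HOME/MARGINS.md
§9.4 (cells 32, 41, 42 — the `Eigensystem` and the `N ≥ 4` tails — are NOT typed: `Bound[Xi,EvenTail,s] := Bound[Xi,2,s]`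
etc., every dropped tail term being `≥ 0`; the eigen leaf is `EigenTails.lean`).  Because `PX` has no subtraction, three
devices are used, each marked in the docstring of the cell concerned: (M2) a division `X/(2d z[s])^k` of a polynomial
bound whose lowest `z`-power is `≥ k` is carried out termwise — the family gets a SHIFT parameter `k` (`bubble m k =
Bound[Bubble,m,s]/(2d z[s])^k`); (M6a) the five exact cancellations (`Bound[G,ik…]`, `PS.M.PE − M₀₀`, `Σ_a PS_a H2_{ab} −
H2_{0b}`, `B − A^ι`, `C₁ − H₂A^ι`, `betatmp − H2₀₀ + WB₂`) are implemented in their reduced, manifestly non-negative form,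
the three walk-count differences `c₆(e₁+e₂) − 36(d−2)²`, `c₄(e₁+e₂) − 2(d−2)`, `c₆(2e₁) − 36(d−2)²` becoming table keys
with a sign hypothesis; (M6c) `mubOverMu = 1/(1 − Bound[G,{1},3,s])` and `1/(1 − Bound[OpenBubble,1,s])` (cell 39) are
ATOMS, valued and proved increasing in `Stage1Frame.lean` on the region where the two denominators are positive.  The
two evaluation points `s ∈ {i, o}` are two VALUATIONS of the same terms (cell 3: `z[i] = 1/(2d−1)`, `z[o] = Γ₁/(2d−1)`,
…; cells 13/14: the weighted constants are `BoundFThreeInital[…]` at `i` and `c_j Γ₃` at `o`).  The LOWER bounds of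
cells 36–37, which contain decreasing brackets, are not `PX` terms: their monotone PIECES are defined here and they
are assembled (with signs) in `Stage1Frame.lean`, as is `mumin` (cell 44).  This file is pure syntax: no real number, no
theorem; its faithfulness to the notebook is checked numerically exactly as `BetaMap.lean` was: the 2 × 60 App. D
inputs, the three `G`'s and 238 intermediate quantities re-evaluated by `PX.evalF` at `d = 11`, `(ComputedSteps,
MaxNumberOfSteps) = (10,20), (12,28), (9,20)`, agree with engine A (HOME/num1/engineA, float back-end) to relative
`1.5e-14` (HOME/lean1 validation log, gen 4; the `Else` branch of cell 6, `RSteps + 2 > MaxNumberOfSteps`, is typed but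
not exercised by these runs).  Natural-number subtractions below are the notebook's integer index arithmetic and never truncate in
the ranges the notebook uses them (`ComputedSteps ≥ 6` even or odd, `MaxNumberOfSteps ≥ ComputedSteps + 4`).

LOCATORS (REFEREE v14 F10 / C24, docstring-only revision by seat lean1 gen 5; no declaration, statement or numeral of
this module changed).  `cell n` = the n-th `### [Input]` block of the transcript HOME/b2b-lace-num3/published/Percolation.txt
(sha256 2ff51cdd3337242adf37c40c9ddef1db426048314d219a1c7a7fe865d917d75e, 1909 lines, 66 Input blocks; the same numbering as the
`# === Input cell n ===` headers of HOME/num1/engineA/Percolation.auto.py), and `transcript l.a–b` = the line range of that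
block in that file (blocks 25 and 28 are empty; the `Vector[…]`/`Matrix[…]` assembly is block 29).  Concordance with the
second transcript HOME/carver/nbtxt/Percolation.txt (sha256 11afeb330497e9abd1d949fe21d1df5d8a3aa825667e12277e24a46434ee9bdd,
1406 lines, `«CELL»`-delimited, the one REFEREE v14 (A) read): cell 11 = its l.250–264, cell 36 = l.739–752, cell 37 = l.758–778.

[cite: FitznerVanDerHofstad2017, notebook Percolation.nb cells 3–43 (transcript l.171–1202)]
-/

namespace Literature.Probability.FitznerVanDerHofstad2017
namespace Stage1Cells

open NoGoFrame (Pt)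

/-! ## Atoms, table keys, parameters -/

/-- The nineteen lattice-point classes of `Percolation.nb` cells 3–43 (Mathematica `{1}` = `e₁`, `{2}` = `e₁+e₂`,
`{0,1}` = `2e₁`, `{1,1}` = `2e₁+e₂`, `{0,0,1}` = `3e₁`, … — the list of multiplicities of the coordinate values `1, 2, 3, …`).
[cite: FitznerVanDerHofstad2017, notebook Percolation.nb cells 5–24 (transcript l.237–769)] -/
inductive V
  | v0 | v1 | v2 | v3 | v4 | v5 | v01 | v11 | v001 | v02 | v12 | v21 | v31 | v101 | v011 | v201 | v0001 | v1001
  | v00001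
  deriving DecidableEq, Repr

/-- STATE ATOMS of stage 1 at the point `s` being evaluated: `z[s]`, `VarGamma2[s]` (cell 3), the six weighted constants
(cells 13/14: `c_j Γ₃` at `o`, `BoundFThreeInital[…]` at `i`), `VarGamma2[o]` (used at both points by cell 9), the
two-point bound `Bound[G,{1},3,t]` at a NAMED point (cell 37 uses it at `o` at both `s`), and the three
DERIVED atoms `mubOverMu[s] = 1/(1 − Bound[G,{1},3,s])` (cell 10), `mubOverMu[i]` (cell 37) and
`1/(1 − Bound[OpenBubble,1,s])` (cell 39). [cite: FitznerVanDerHofstad2017, notebook Percolation.nb cells 3, 9, 10, 13, 14, 37, 39] -/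
inductive Atom
  | z | V | cw (j : Fin 6) | Vo | G13at (t : Pt) | mubOverMu | mubOverMuI | hdInv
  deriving DecidableEq

/-- TABLE KEYS: the SRW integrals `Ivalue[n,l,v]`, `K[n,l,v]` of `SRW.nb`, the walk counts `nrSAW[j,d,v]`,
`nrBAW[j,d,v]`, and the three walk-count DIFFERENCES of cells 7–8 (`nrSAW[6,d,{2}] − 36(d−2)²`,
`nrSAW[4,d,{2}] − 2(d−2)`, `nrSAW[6,d,{0,1}] − 36(d−2)²`, device M6a). [cite: FitznerVanDerHofstad2017, notebook Percolation.nb cells 5–8 (transcript l.237–310)] -/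
inductive TKey
  | I (n l : ℕ) (v : V) | K (n l : ℕ) (v : V) | saw (j : ℕ) (v : V) | baw (j : ℕ) (v : V)
  | sawIk6 | sawIk4 | sawTwoi6
  deriving DecidableEq

/-- The integer parameters: dimension `d`, `ComputedSteps`, `MaxNumberOfSteps` (cell 2). [cite: FitznerVanDerHofstad2017, notebook Percolation.nb cell 2 (transcript l.134–143)] -/
structure Params where
  /-- dimension -/
  d : ℕ
  /-- `ComputedSteps` -/
  CS : ℕ
  /-- `MaxNumberOfSteps` -/
  MS : ℕ

/-- stage-1 terms. [folklore] -/
abbrev T := PX Atom TKey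
/-- vectors `(·)_{a}, a = 0,1,2`. [folklore] -/
abbrev Vec := Fin 3 → T
/-- `3 × 3` matrices. [folklore] -/
abbrev Mat := Fin 3 → Fin 3 → T

open PX

/-! ## Linear algebra on `PX` terms (Mathematica `Dot`, `Transpose`), written out for `3 × 3` -/

/-- `u.v` [folklore] -/
def dot (u v : Vec) : T := u 0 * v 0 + u 1 * v 1 + u 2 * v 2
/-- `u.M` (row vector times matrix) [folklore] -/
def vecMul (u : Vec) (M : Mat) : Vec := fun b => u 0 * M 0 b + u 1 * M 1 b + u 2 * M 2 b
/-- `M.v` [folklore] -/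
def mulVec (M : Mat) (v : Vec) : Vec := fun a => M a 0 * v 0 + M a 1 * v 1 + M a 2 * v 2
/-- `M.N` [folklore] -/
def matMul (M N : Mat) : Mat := fun a b => M a 0 * N 0 b + M a 1 * N 1 b + M a 2 * N 2 b
/-- `M + N` [folklore] -/
def madd (M N : Mat) : Mat := fun a b => M a b + N a b
/-- `c M` [folklore] -/
def smul (c : T) (M : Mat) : Mat := fun a b => c * M a b
/-- `u + v` [folklore] -/
def vadd (u v : Vec) : Vec := fun a => u a + v a
/-- `Transpose[M]` [folklore] -/
def tr (M : Mat) : Mat := fun a b => M b a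
/-- `e0 = {1,0,0}` (cell 38) [folklore] -/
def e0 : Vec := ![1, 0, 0]

section Cells

variable (P : Params)

/-! ## Cells 3–4: the evaluation points and the step counts -/

/-- `z[s]` (cell 3; the point is chosen by the valuation).
[cite: FitznerVanDerHofstad2017, notebook Percolation.nb cell 3] -/
def z : T := atom .z
/-- `VarGamma2[s]` (cell 3). [cite: FitznerVanDerHofstad2017, notebook Percolation.nb cell 3] -/
def Vg : T := atom .V
/-- `2d z[s]`, the recurring base. [folklore] -/
def w : T := C (2 * P.d) * z
/-- `z[i] = 1/(2d−1)` (cell 3), a constant term. [cite: FitznerVanDerHofstad2017, notebook Percolation.nb cell 3 (transcript l.171–175)] -/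
def zI : T := C 1 /ₙ (2 * P.d - 1)
/-- `Explicit` (cell 4): `ComputedSteps` rounded down to an even number. [cite: FitznerVanDerHofstad2017, notebook Percolation.nb cell 4 (transcript l.217–222)] -/
def Params.E : ℕ := 2 * (P.CS / 2)
/-- `RSteps = Explicit + 2` (cell 4). [cite: FitznerVanDerHofstad2017, notebook Percolation.nb cell 4 (transcript l.217–222)] -/
def Params.R : ℕ := P.E + 2
/-- `z[s]^j/(2d z[s])^k = z[s]^(j−k)/(2d)^k` (device M2; used with `k ≤ j`). [folklore] -/
def zsh (j k : ℕ) : T := z ^ (j - k) /ₙ ((2 * P.d) ^ k)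

/-! ## Cells 5–10: two-point function bounds -/

/-- Cell 5: `Bound[G,{1},m,s] = Σ_{j=m}^{Explicit} z^j nrSAW[j,d,{1}] + (2dz)^{RSteps−1} VarGamma2 Ivalue[1,RSteps,{0}]`.
[cite: FitznerVanDerHofstad2017, notebook Percolation.nb cell 5 (transcript l.237–241)] -/
def G1 (m : ℕ) : T :=
  sumR m P.E (fun j => z ^ j * tab (.saw j .v1)) + w P ^ (P.R - 1) * Vg * tab (.I 1 P.R .v0)

/-- Cell 6 from the lower index `n` on (`n = 2m` in the notebook; `n = 7` is used by the reduced cell 7):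
`Σ_{j=n}^{…} z^j nrSAW[j,d,{2}] + (d/(d−1)) (2dz)^{…} VarGamma2 Ivalue[1,…,{0}]` with the `If[RSteps+2 ≤ MaxNumberOfSteps]` branch.
[cite: FitznerVanDerHofstad2017, notebook Percolation.nb cell 6 (transcript l.256–261)] -/
def G2 (n : ℕ) : T :=
  if P.R + 2 ≤ P.MS then
    sumR n P.E (fun j => z ^ j * tab (.saw j .v2)) + C P.d * w P ^ P.R * Vg * tab (.I 1 (P.R + 2) .v0) /ₙ (P.d - 1)
  else
    sumR n (P.MS - 4) (fun j => z ^ j * tab (.saw j .v2))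
      + C P.d * w P ^ (P.MS - 2) * Vg * tab (.I 1 P.MS .v0) /ₙ (P.d - 1)

/-- Cell 7, reduced (device M6a): `Bound[G,ik,6,s] = Bound[G,{2},6,s] − 36(d−2)² z^6 = z^6 (nrSAW[6,d,{2}] − 36(d−2)²) +
(cell 6 from j = 7)` — valid for `ComputedSteps ≥ 6`. [cite: FitznerVanDerHofstad2017, notebook Percolation.nb cell 7 (transcript l.277–281)] -/
def Gik6 : T := z ^ 6 * tab .sawIk6 + G2 P 7
/-- Cell 7: `Bound[G,ik,4,s] = z^4 (nrSAW[4,d,{2}] − 2(d−2)) + Bound[G,ik,6,s]`. [cite: FitznerVanDerHofstad2017, notebook Percolation.nb cell 7 (transcript l.277–281)] -/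
def Gik4 : T := z ^ 4 * tab .sawIk4 + Gik6 P
/-- Cell 7: `Bound[G,ik,2,s] = z^2 + Bound[G,ik,4,s]`. [cite: FitznerVanDerHofstad2017, notebook Percolation.nb cell 7 (transcript l.277–281)] -/
def Gik2 : T := z ^ 2 + Gik4 P

/-- Cell 8 from the lower index `n` on: `Σ_{j=n}^{Explicit} z^j nrSAW[j,d,{0,1}] + (2dz)^{RSteps} VarGamma2 Ivalue[1,RSteps,{0}]`.
[cite: FitznerVanDerHofstad2017, notebook Percolation.nb cell 8 (transcript l.303–310)] -/
def G01 (n : ℕ) : T :=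
  sumR n P.E (fun j => z ^ j * tab (.saw j .v01)) + w P ^ P.R * Vg * tab (.I 1 P.R .v0)
/-- Cell 8, reduced (M6a): `Bound[G,twoi,6,s] = Bound[G,{0,1},6,s] − 36(d−2)² z^6`. [cite: FitznerVanDerHofstad2017, notebook Percolation.nb cell 8 (transcript l.303–310)] -/
def Gtwoi6 : T := z ^ 6 * tab .sawTwoi6 + G01 P 7
/-- Cell 8: `Bound[G,twoi,4,s] = 2(d−1) z^4 + Bound[G,twoi,6,s]`. [cite: FitznerVanDerHofstad2017, notebook Percolation.nb cell 8 (transcript l.303–310)] -/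
def Gtwoi4 : T := C (2 * (P.d - 1)) * z ^ 4 + Gtwoi6 P
/-- Cell 8: `Bound[G,twoi,2,s] = Bound[G,twoi,4,s]`. [cite: FitznerVanDerHofstad2017, notebook Percolation.nb cell 8 (transcript l.303–310)] -/
def Gtwoi2 : T := Gtwoi4 P

/-- `maxpossible = Max[Explicit, MaxNumberOfSteps/2]` (cell 9). [cite: FitznerVanDerHofstad2017, notebook Percolation.nb cell 9 (transcript l.334–343)] -/
def Params.mp : ℕ := max P.E (P.MS / 2)
/-- Cell 9, the recursion `Bound[G,max,maxpossible−2t,s]`, `t = 0, 1, …`: top `(2dz)^{maxpossible} VarGamma2[o]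
K[1,maxpossible,{1}]` (NB: `VarGamma2[o]` at both points, as coded), step `Max[nrSAW[m,d,{2}] z^m, nrSAW[m+1,d,{1}] z^{m+1}] + (previous)`.
[cite: FitznerVanDerHofstad2017, notebook Percolation.nb cell 9 (transcript l.334–343)] -/
def GmaxT : ℕ → T
  | 0 => w P ^ P.mp * atom .Vo * tab (.K 1 P.mp .v1)
  | t + 1 =>
      max (tab (.saw (P.mp - 2 * (t + 1)) .v2) * z ^ (P.mp - 2 * (t + 1)))
          (tab (.saw (P.mp - 2 * (t + 1) + 1) .v1) * z ^ (P.mp - 2 * (t + 1) + 1))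
        + GmaxT t
/-- Cell 9: `Bound[G,max,1,s] = Max[Bound[G,max,2,s], Bound[G,{1},1,s]]`. [cite: FitznerVanDerHofstad2017, notebook Percolation.nb cell 9 (transcript l.334–343)] -/
def Gmax1 : T := max (GmaxT P ((P.mp - 2) / 2)) (G1 P 1)

/-- `Bound[G,{1},3,s]` (the argument of `mubOverMu`, cell 10).
[cite: FitznerVanDerHofstad2017, notebook Percolation.nb cell 10] -/
abbrev G13 : T := G1 P 3
/-- Cell 10: `mubOverMu[s] = 1/(1 − Bound[G,{1},3,s])` — a derived ATOM (device M6c). [cite: FitznerVanDerHofstad2017, notebook Percolation.nb cell 10 (transcript l.361–363)] -/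
def mubOverMu : T := atom .mubOverMu

/-! ## Cells 11–12: repulsive and open diagrams (with the shift `k` of device M2) -/

/-- Cell 11: `Bound[Loop,4,s] = 2dz Bound[G,{1},3,s]`. [cite: FitznerVanDerHofstad2017, notebook Percolation.nb cell 11 (transcript l.389–404)] -/
def Loop4 : T := w P * G13 P

/-- Cell 11: `Bound[Bubble,m,s]/(2dz)^k = Σ_{j=m}^{Explicit} (j+1−m) nrBAW[j,d,{0}] z^j/(2dz)^k + (RSteps−m)(2dz)^{RSteps−k}
VarGamma2 I[1,RSteps,{0}] + (2dz)^{RSteps−k} VarGamma2² I[2,RSteps,{0}]` (`k = 0` is the cell; `k ≤ 2 ≤ m` used).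
[cite: FitznerVanDerHofstad2017, notebook Percolation.nb cell 11 (transcript l.389–404)] -/
def bubble (m k : ℕ) : T :=
  sumR m P.E (fun j => C (j + 1 - m) * tab (.baw j .v0) * zsh P j k)
    + C (P.R - m) * w P ^ (P.R - k) * Vg * tab (.I 1 P.R .v0)
    + w P ^ (P.R - k) * Vg ^ 2 * tab (.I 2 P.R .v0)

/-- Cell 11: `Bound[Triangle,m,s]/(2dz)^k`. [cite: FitznerVanDerHofstad2017, notebook Percolation.nb cell 11 (transcript l.389–404)] -/
def triangle (m k : ℕ) : T :=
  sumR m P.E (fun j => C (j + 1 - m) * C (j + 2 - m) * tab (.baw j .v0) * zsh P j k /ₙ 2)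
    + C (P.R - m) * C (P.R - 1 - m) * w P ^ (P.R - k) * Vg * tab (.I 1 P.R .v0) /ₙ 2
    + C (P.R + 1 - m) * w P ^ (P.R - k) * Vg ^ 2 * tab (.I 2 P.R .v0)
    + w P ^ (P.R - k) * Vg ^ 3 * tab (.I 3 P.R .v0)

/-- Cell 11: `Bound[Square,m,s]/(2dz)^k`. [cite: FitznerVanDerHofstad2017, notebook Percolation.nb cell 11 (transcript l.389–404)] -/
def square (m k : ℕ) : T :=
  sumR m P.E (fun j => C (j + 1 - m) * C (j + 2 - m) * C (j + 3 - m) * tab (.baw j .v0) * zsh P j k /ₙ 6)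
    + C (P.R + 1 - m) * C (P.R + 2 - m) * C (P.R + 3 - m) * w P ^ (P.R - k) * Vg * tab (.I 1 P.R .v0) /ₙ 6
    + C (P.R - m) * C (P.R - 1 - m) * w P ^ (P.R - k) * Vg ^ 2 * tab (.I 2 P.R .v0) /ₙ 2
    + C (P.R - m) * w P ^ (P.R - k) * Vg ^ 3 * tab (.I 3 P.R .v0)
    + w P ^ (P.R - k) * Vg ^ 4 * tab (.I 4 P.R .v0)

/-- Cell 12: `Bound[OpenBubble,m,s]/(2dz)^k = Min[(2dz)^{m−k} VarGamma2² K[2,m,{1}], Max[Σ_{j=m}^{CS} (j+1−m) z^j nrBAW[j,d,{2}],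
Σ … nrBAW[j,d,{1}]]/(2dz)^k + (CS+1−m)(2dz)^{CS+1−k} K[1,CS+1,{1}] + (2dz)^{CS+1−k} VarGamma2² K[2,CS+1,{1}]]`
(NB: no `VarGamma2` on the `K[1,…]` term, as coded). [cite: FitznerVanDerHofstad2017, notebook Percolation.nb cell 12 (transcript l.419–429)] -/
def openBubble (m k : ℕ) : T :=
  min (w P ^ (m - k) * Vg ^ 2 * tab (.K 2 m .v1))
    (max (sumR m P.CS fun j => C (j + 1 - m) * zsh P j k * tab (.baw j .v2))
         (sumR m P.CS fun j => C (j + 1 - m) * zsh P j k * tab (.baw j .v1))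
      + C (P.CS + 1 - m) * w P ^ (P.CS + 1 - k) * tab (.K 1 (P.CS + 1) .v1)
      + w P ^ (P.CS + 1 - k) * Vg ^ 2 * tab (.K 2 (P.CS + 1) .v1))

/-- Cell 12: `Bound[OpenTriangle,m,s]/(2dz)^k`, AS CODED — the `Max[…]` MULTIPLIES the first tail term (HOME/DIVERGENCE.md
D12; [FvdH17] has a sum); the shift acts on the `(2dz)^{CS+1}` factors. [cite: FitznerVanDerHofstad2017, notebook Percolation.nb cell 12 (transcript l.419–429)] -/
def openTriangle (m k : ℕ) : T :=
  min (w P ^ (m - k) * Vg ^ 3 * tab (.K 3 m .v1))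
    (max (sumR m P.CS fun j => C (j + 1 - m) * C (j + 2 - m) * z ^ j * tab (.baw j .v2) /ₙ 2)
         (sumR m P.CS fun j => C (j + 1 - m) * C (j + 2 - m) * z ^ j * tab (.baw j .v1) /ₙ 2)
        * C (P.CS + 1 - m) * C (P.CS - m) * w P ^ (P.CS + 1 - k) * Vg * tab (.K 1 (P.CS + 1) .v1) /ₙ 2
      + C (P.CS + 1 - m) * w P ^ (P.CS + 1 - k) * Vg ^ 2 * tab (.K 2 (P.CS + 1) .v1)
      + w P ^ (P.CS + 1 - k) * Vg ^ 3 * tab (.K 3 (P.CS + 1) .v1))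

/-- Cell 12: `Bound[OpenSquare,m,s]/(2dz)^k`, AS CODED (product form, and the literal `10`s of HOME/DIVERGENCE.md D26).
[cite: FitznerVanDerHofstad2017, notebook Percolation.nb cell 12 (transcript l.419–429)] -/
def openSquare (m k : ℕ) : T :=
  min (w P ^ (m - k) * Vg ^ 4 * tab (.K 4 m .v1))
    (max (sumR m P.CS fun j => C (j + 1 - m) * C (j + 2 - m) * C (j + 3 - m) * z ^ j * tab (.baw j .v2) /ₙ 6)
         (sumR m P.CS fun j => C (j + 1 - m) * C (j + 2 - m) * C (j + 3 - m) * z ^ j * tab (.baw j .v1) /ₙ 6)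
        * C (10 + 1 - m) * C (10 + 2 - m) * C (10 + 3 - m) * w P ^ (P.CS + 1 - k) * Vg * tab (.K 1 (P.CS + 1) .v1) /ₙ 6
      + C (10 - m) * C (10 - 1 - m) * w P ^ (P.CS + 1 - k) * Vg ^ 2 * tab (.K 2 (P.CS + 1) .v1) /ₙ 2
      + C (10 - m) * w P ^ (P.CS + 1 - k) * Vg ^ 3 * tab (.K 3 (P.CS + 1) .v1)
      + w P ^ (P.CS + 1 - k) * Vg ^ 4 * tab (.K 4 (P.CS + 1) .v1))

/-! ## Cells 13–15: weighted diagrams -/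

/-- Cells 13/14: `Bound[WeightedBubble,6,s]/(2dz)^k = (2dz)^{6−k} × (c_{1,6,0} Γ₃ at o | BoundFThreeInital[d,1,6,1,{{0}}] at i)`.
[cite: FitznerVanDerHofstad2017, notebook Percolation.nb cells 13–14 (transcript l.447–471)] -/
def wb6 (k : ℕ) : T := w P ^ (6 - k) * atom (.cw 0)
/-- Cells 13/14: `Bound[WeightedOpenLine,0,s] = c_{0,0,1} Γ₃ | BoundFThreeInital[d,0,0,1,{{1},{2},{0,1}}]`. [cite: FitznerVanDerHofstad2017, notebook Percolation.nb cells 13–14 (transcript l.447–471)] -/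
def wol0 : T := atom (.cw 1)
/-- Cells 13/14: `Bound[WeightedOpenBubble,t,s]/(2dz)^k = (2dz)^{t−k} × (c_{1,t,1} Γ₃ | BoundFThreeInital[d,1,t,1,…])`, `t = 0..3`.
[cite: FitznerVanDerHofstad2017, notebook Percolation.nb cells 13–14 (transcript l.447–471)] -/
def wob (t k : ℕ) : T := w P ^ (t - k) * atom (.cw ⟨min (t + 2) 5, by omega⟩)

/-- `explicit = Min[MaxNumberOfSteps/2 − 2, ComputedSteps]` (cell 15). [cite: FitznerVanDerHofstad2017, notebook Percolation.nb cell 15 (transcript l.482–503)] -/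
def Params.ex : ℕ := min (P.MS / 2 - 2) P.CS
/-- `rem = explicit + 1` (cell 15). [cite: FitznerVanDerHofstad2017, notebook Percolation.nb cell 15 (transcript l.482–503)] -/
def Params.rem : ℕ := P.ex + 1
/-- the inner factor of cell 15: `Σ_{r=1}^{explicit} nrSAW[r,d,u] z^r + (2dz)^{rem} K[1,rem,u']`.
[cite: FitznerVanDerHofstad2017, notebook Percolation.nb cell 15] -/
def wbIn (u u' : V) : T := sumR 1 P.ex (fun r => tab (.saw r u) * z ^ r) + w P ^ P.rem * tab (.K 1 P.rem u')
/-- `point5Remainder` (cell 15). [cite: FitznerVanDerHofstad2017, notebook Percolation.nb cell 15] -/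
def point5Remainder : List V := [.v11, .v001, .v00001, .v1001, .v011, .v201, .v12, .v31]
/-- `point4Remainder` (cell 15). [cite: FitznerVanDerHofstad2017, notebook Percolation.nb cell 15] -/
def point4Remainder : List V := [.v01, .v101, .v0001, .v02, .v21]

/-- Cell 15: `Bound[WeightedBubble,5,s]/(2dz)^k` (class substitutions as coded, HOME/DIVERGENCE.md D15). [cite: FitznerVanDerHofstad2017, notebook Percolation.nb cell 15 (transcript l.482–503)] -/
def wb5 (k : ℕ) : T :=
  wb6 P k
    + zsh P 5 k * tab (.saw 5 .v1) * wbIn P .v1 .v1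
    + C 3 * zsh P 5 k * tab (.saw 5 .v3) * wbIn P .v1 .v2
    + C 5 * zsh P 5 k * tab (.saw 5 .v5) * wbIn P .v5 .v2
    + C 25 * zsh P 5 k * sumL point5Remainder (fun v => tab (.saw 5 v) * wbIn P v .v01)
/-- Cell 15: `Bound[WeightedBubble,4,s]/(2dz)^k`. [cite: FitznerVanDerHofstad2017, notebook Percolation.nb cell 15 (transcript l.482–503)] -/
def wb4 (k : ℕ) : T :=
  wb5 P k
    + C 2 * zsh P 4 k * tab (.saw 4 .v2) * wbIn P .v2 .v2
    + C 4 * zsh P 4 k * tab (.saw 4 .v4) * wbIn P .v2 .v2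
    + C 16 * sumL point4Remainder (fun v => zsh P 4 k * tab (.saw 4 v) * wbIn P v .v01)
/-- Cell 15: `Bound[WeightedBubble,3,s]/(2dz)^k`. [cite: FitznerVanDerHofstad2017, notebook Percolation.nb cell 15 (transcript l.482–503)] -/
def wb3 (k : ℕ) : T :=
  wb4 P k
    + zsh P 3 k * tab (.saw 3 .v1) * wbIn P .v1 .v1
    + C 5 * zsh P 3 k * tab (.saw 3 .v11) * wbIn P .v11 .v01
    + C 9 * zsh P 3 k * tab (.saw 3 .v001) * wbIn P .v001 .v01
    + C 3 * zsh P 3 k * tab (.saw 3 .v3) * wbIn P .v3 .v2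
/-- Cell 15: `Bound[WeightedBubble,2,s]/(2dz)^k = WB3 + 8d z² Gtwoi4 + 4d(2d−2) z^4 + 8d(2d−2) z² Gik4` (shifted; `k ≤ 2`).
[cite: FitznerVanDerHofstad2017, notebook Percolation.nb cell 15 (transcript l.482–503)] -/
def wb2 (k : ℕ) : T :=
  wb3 P k
    + (C (2 * P.d * 4) * zsh P 2 k * Gtwoi4 P + C 2 * zsh P 4 k * C 2 * C P.d * C (2 * P.d - 2)
        + C (2 * 2) * zsh P 2 k * C 2 * C P.d * C (2 * P.d - 2) * Gik4 P)
/-- Cell 15: `Bound[WeightedBubble,1,s]/(2dz)^k = WB2 + (2dz)^{1−k} G13` (`k ≤ 1`). [cite: FitznerVanDerHofstad2017, notebook Percolation.nb cell 15 (transcript l.482–503)] -/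
def wb1 (k : ℕ) : T := wb2 P k + w P ^ (1 - k) * G13 P
/-- Cell 15: `Bound[WeightedBubble,0,s] = Bound[WeightedBubble,1,s]`.
[cite: FitznerVanDerHofstad2017, notebook Percolation.nb cell 15] -/
def wb0 : T := wb1 P 0

/-! ## Cells 16–17: the vectors `P^S`, `P^E`, `P^ι` -/

/-- Cell 16: `Bound[PS,a,s]` = `(1 + ½B₂, Loop₄ + B₃, T₄ + ½B₂)`. [cite: FitznerVanDerHofstad2017, notebook Percolation.nb cell 16 (transcript l.527–534)] -/
def PS : Vec := ![1 + bubble P 2 0 /ₙ 2, Loop4 P + bubble P 3 0, triangle P 4 0 + bubble P 2 0 /ₙ 2]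
/-- Cell 16: `Bound[PE,a,s]` = `(1 + ½B₂, B₃, T₄)`. [cite: FitznerVanDerHofstad2017, notebook Percolation.nb cell 16 (transcript l.527–534)] -/
def PE : Vec := ![1 + bubble P 2 0 /ₙ 2, bubble P 3 0, triangle P 4 0]
/-- Cell 29 (`Vector[PSNT,s]`; Input cell 28 is empty): `PSNT = PS − (1,0,0)` in reduced form (M6a). [cite: FitznerVanDerHofstad2017, notebook Percolation.nb cell 29 (transcript l.829–857)] -/
def PSNT : Vec := ![bubble P 2 0 /ₙ 2, Loop4 P + bubble P 3 0, triangle P 4 0 + bubble P 2 0 /ₙ 2]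
/-- Cell 29 (`Vector[PENT,s]`; Input cell 28 is empty): `PENT = PE − (1,0,0)` in reduced form (M6a). [cite: FitznerVanDerHofstad2017, notebook Percolation.nb cell 29 (transcript l.829–857)] -/
def PENT : Vec := ![bubble P 2 0 /ₙ 2, bubble P 3 0, triangle P 4 0]
/-- Cell 17: `Bound[Piota,a,s]`. [cite: FitznerVanDerHofstad2017, notebook Percolation.nb cell 17 (transcript l.543–547)] -/
def Piota : Vec :=
  ![C 1 /ₙ (2 * P.d) + G13 P * (1 + bubble P 2 0 /ₙ 2),
    G13 P * (1 + PS P 1),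
    G13 P * PS P 2 + G13 P + bubble P 4 1 + (G13 P + bubble P 3 1) * (C 1 /ₙ 2) * bubble P 2 0]

/-! ## Cells 18–24: the matrices -/

/-- Cell 18: `Bound[A,a,b,s]` (and, by cell 29 AS CODED, also `Matrix[ANonRep]`: HOME/DIVERGENCE.md D16).
[cite: FitznerVanDerHofstad2017, notebook Percolation.nb cells 18, 29 (transcript l.559–580, l.829–857)] -/
def A : Mat :=
  !![bubble P 2 0 /ₙ 2, bubble P 3 0, triangle P 4 0;
     bubble P 3 1, bubble P 3 1, triangle P 4 1;
     openBubble P 1 0, openBubble P 2 0, openTriangle P 3 0]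
/-- Cell 19: `Bound[Aiota,a,b,s]`. [cite: FitznerVanDerHofstad2017, notebook Percolation.nb cell 19 (transcript l.592–612)] -/
def Aiota : Mat :=
  !![bubble P 3 0, bubble P 3 0, triangle P 4 0;
     bubble P 3 1, bubble P 3 1, triangle P 3 1;
     openBubble P 2 0, openBubble P 2 0, openTriangle P 3 0]
/-- Cell 19: `Bound[AiotaNonRep,a,b,s]`. [cite: FitznerVanDerHofstad2017, notebook Percolation.nb cell 19 (transcript l.592–612)] -/
def AiotaNR : Mat :=
  !![bubble P 3 0, w P ^ 4 * Vg * tab (.I 1 4 .v0) + w P ^ 4 * Vg ^ 2 * tab (.I 2 4 .v0), w P ^ 4 * Vg ^ 3 * tab (.I 3 4 .v0);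
     w P ^ 3 * Vg * tab (.I 1 4 .v0) + w P ^ 3 * Vg ^ 2 * tab (.I 2 4 .v0),
       w P ^ 3 * Vg * tab (.I 1 4 .v0) + w P ^ 3 * Vg ^ 2 * tab (.I 2 4 .v0), w P ^ 3 * Vg ^ 3 * tab (.I 3 4 .v0);
     w P ^ 2 * Vg ^ 2 * tab (.K 2 2 .v1), w P ^ 2 * Vg ^ 2 * tab (.K 2 2 .v1), w P ^ 3 * Vg ^ 3 * tab (.K 3 3 .v1)]
/-- Cell 20: `Bound[AiotabarNonRep,a,b,s]` (column 1 = column 1 of `AiotaNonRep` divided by `2dz`, device M2).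
[cite: FitznerVanDerHofstad2017, notebook Percolation.nb cell 20 (transcript l.624–640)] -/
def AiotabarNR : Mat :=
  !![bubble P 3 0, w P ^ 3 * Vg * tab (.I 1 4 .v0) + w P ^ 3 * Vg ^ 2 * tab (.I 2 4 .v0), w P ^ 2 * Vg ^ 2 * tab (.K 2 2 .v1);
     w P ^ 3 * Vg * tab (.I 1 4 .v0) + w P ^ 3 * Vg ^ 2 * tab (.I 2 4 .v0),
       w P ^ 2 * Vg * tab (.I 1 4 .v0) + w P ^ 2 * Vg ^ 2 * tab (.I 2 4 .v0), w P * Vg ^ 2 * tab (.K 2 2 .v0);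
     w P ^ 2 * Vg ^ 2 * tab (.K 2 2 .v1), w P * Vg ^ 2 * tab (.K 2 2 .v1), w P * Vg ^ 2 * tab (.K 2 1 .v0)]
/-- Cell 20: `Bound[AiotaBar,a,b,s]` (column 1 = column 1 of `Aiota` divided by `2dz`). [cite: FitznerVanDerHofstad2017, notebook Percolation.nb cell 20 (transcript l.624–640)] -/
def AiotaBar : Mat :=
  !![bubble P 3 0, bubble P 3 1, openBubble P 2 0;
     bubble P 3 1, bubble P 3 2, w P * Vg ^ 2 * tab (.K 2 2 .v0);
     openBubble P 2 0, openBubble P 2 1, w P * Vg ^ 2 * tab (.K 2 1 .v0)]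
/-- Cell 21: `Bound[B2i,a,b,s]` (only column 2 is non-zero). [cite: FitznerVanDerHofstad2017, notebook Percolation.nb cell 21 (transcript l.649–657)] -/
def B2i : Mat :=
  !![0, 0, bubble P 3 1 * triangle P 4 0 + triangle P 4 0 * openTriangle P 3 0;
     0, 0, bubble P 3 1 * triangle P 4 1 + triangle P 4 1 * openTriangle P 3 0;
     0, 0, bubble P 3 1 * openTriangle P 3 0 + openBubble P 2 0 * openTriangle P 4 0]
/-- Cell 22: `Bound[Bbar2i,a,b,s]`. [cite: FitznerVanDerHofstad2017, notebook Percolation.nb cell 22 (transcript l.666–676)] -/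
def Bbar2i : Mat :=
  !![0, 0, 0;
     bubble P 2 0 /ₙ 2 * openTriangle P 3 0, bubble P 2 1 /ₙ 2 * openTriangle P 3 0, bubble P 2 0 /ₙ 2 * Gmax1 P ^ 2;
     bubble P 2 0 /ₙ 2 * openTriangle P 4 0 + bubble P 3 1 * triangle P 4 0 + triangle P 4 0 * openTriangle P 3 0,
       bubble P 2 1 /ₙ 2 * openTriangle P 4 0 + bubble P 3 2 * triangle P 4 0 + triangle P 4 1 * openTriangle P 3 0,
       bubble P 2 0 /ₙ 2 * Gmax1 P * openBubble P 2 0 + openTriangle P 3 0 * bubble P 3 1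
         + Gmax1 P * openBubble P 1 0 * triangle P 4 0]
/-- Cell 23: `Bound[H1,a,b,s] = Bound[H2,a,b,s]`. [cite: FitznerVanDerHofstad2017, notebook Percolation.nb cell 23 (transcript l.694–722)] -/
def H1 : Mat :=
  !![wb2 P 0, wb2 P 1, wob P 0 0;
     wb2 P 1, wb2 P 2, wob P 1 1;
     wob P 0 0, wob P 1 1, wob P 0 0]
/-- Cell 23: `Bound[H2,…] = Bound[H1,…]`. [cite: FitznerVanDerHofstad2017, notebook Percolation.nb cell 23] -/
abbrev H2 : Mat := H1 P
/-- Cell 23: `Bound[H3,a,b,s]`. [cite: FitznerVanDerHofstad2017, notebook Percolation.nb cell 23 (transcript l.694–722)] -/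
def H3 : Mat :=
  !![wb2 P 0, wb2 P 1, wob P 1 0;
     wb2 P 1, wb3 P 2, wob P 2 1;
     wob P 1 0, wob P 2 1, wob P 1 0]
/-- `Max[Ivalue[2,2,{0}], K[2,1,{2}], K[2,1,{0,1}]]` of cell 24.
[cite: FitznerVanDerHofstad2017, notebook Percolation.nb cell 24] -/
def mx24 : T := max (max (tab (.I 2 2 .v0)) (tab (.K 2 1 .v2))) (tab (.K 2 1 .v01))
/-- Cell 24: `Bound[C3,a,b,s]`. [cite: FitznerVanDerHofstad2017, notebook Percolation.nb cell 24 (transcript l.758–769)] -/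
def C3 : Mat :=
  !![wol0 * openTriangle P 3 0 * square P 4 0 + wb1 P 0 * openBubble P 2 0 * triangle P 3 0,
       wol0 * openTriangle P 3 1 * square P 4 0 + wb1 P 0 * openBubble P 2 1 * triangle P 3 0,
       wol0 * openTriangle P 3 0 * openSquare P 3 0 + wb1 P 0 * w P * Vg ^ 2 * mx24 * triangle P 3 0;
     wol0 * openTriangle P 3 1 * square P 4 0 + wb1 P 0 * openBubble P 2 0 * triangle P 3 1,
       wol0 * openTriangle P 3 1 * square P 4 1 + wb1 P 0 * openBubble P 2 1 * triangle P 3 1,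
       wol0 * w P ^ 2 * Vg ^ 3 * tab (.I 3 2 .v0) * square P 4 1 + wb1 P 0 * w P * Vg ^ 2 * mx24 * triangle P 4 1;
     wol0 * openTriangle P 3 0 * openSquare P 3 0 + wb1 P 0 * openBubble P 2 0 * openTriangle P 2 0,
       wol0 * w P ^ 2 * Vg ^ 3 * tab (.I 3 2 .v0) * square P 4 1 + wb1 P 0 * openBubble P 2 1 * openTriangle P 2 0,
       wol0 * w P ^ 2 * Vg ^ 3 * tab (.I 3 2 .v0) * openSquare P 3 0 + wb1 P 0 * w P * Vg ^ 2 * mx24 * openTriangle P 2 0]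

/-! ## Cells 26–31: `h^ι`, `h^{ιι}`, `B`, `B̄`, `C₁`, `C₂` -/

/-- Cell 26: `Bound[hi,part1,b,s]` = `(WB₂/(2d), WB₂/((2d)²z), WOB₁/(2d))`. [cite: FitznerVanDerHofstad2017, notebook Percolation.nb cell 26 (transcript l.787–800)] -/
def hiP1 : Vec := ![wb2 P 0 /ₙ (2 * P.d), wb2 P 1 /ₙ (2 * P.d), wob P 1 0 /ₙ (2 * P.d)]
/-- Cell 26: `Bound[hi,part2,b,s]` (with `AiotaNonRep`, `AiotabarNonRep`), `Σ_a PS_a H2_{ab} − H2_{0b} = PSNT.H2_{·b}` (M6a). [cite: FitznerVanDerHofstad2017, notebook Percolation.nb cell 26 (transcript l.787–800)] -/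
def hiP2 (b : Fin 3) : T :=
  G13 P * H2 P 0 b + C 2 * G13 P * vecMul (PSNT P) (H2 P) b
    + C 2 * G13 P *
      (wb1 P 0 /ₙ 2 * AiotaNR P b 0 + wb1 P 1 * AiotaNR P b 1
        + min (min (wob P 0 0 * AiotaNR P b 2) (wob P 1 0 * AiotaNR P b 2 + wb1 P 0 /ₙ 2 * AiotabarNR P b 2))
            (wob P 1 0 * AiotaNR P b 2 + wol0 /ₙ 2 * AiotaNR P b 2))
/-- Cell 26: `Bound[hi,part3,b,s]`. [cite: FitznerVanDerHofstad2017, notebook Percolation.nb cell 26 (transcript l.787–800)] -/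
def hiP3 (b : Fin 3) : T :=
  G13 P * H2 P 1 b + bubble P 4 1 * H2 P 2 b
    + C 2 * (G13 P + bubble P 3 1) *
      (bubble P 2 0 /ₙ 2 * max (H2 P 1 b) (H2 P 2 b) + wb1 P 0 /ₙ 2 * max (AiotabarNR P 1 b) (AiotabarNR P 2 b))
/-- Cell 26: `Bound[hi,b,s] = part1 + part2 + part3`. [cite: FitznerVanDerHofstad2017, notebook Percolation.nb cell 26 (transcript l.787–800)] -/
def hi : Vec := fun b => hiP1 P b + hiP2 P b + hiP3 P b
/-- Cell 27: `Bound[hII,b,s] = hi_b + 2 Σ_a (hi_a AiotaNonRep_{ab} + Σ_c Piota_a AiotaNonRep_{ac} H2_{cb})`.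
[cite: FitznerVanDerHofstad2017, notebook Percolation.nb cell 27 (transcript l.809–813)] -/
def hII : Vec := fun b =>
  hi P b + C 2 * sumL [(0 : Fin 3), 1, 2] (fun a =>
    hi P a * AiotaNR P a b + sumL [(0 : Fin 3), 1, 2] (fun c => Piota P a * AiotaNR P a c * H2 P c b))
/-- Cell 29: `hS = (H1_{0,b})_b`. [cite: FitznerVanDerHofstad2017, notebook Percolation.nb cell 29] -/
def hS : Vec := fun b => H1 P 0 b
/-- Cell 29: `hE = (H3_{0,b})_b`. [cite: FitznerVanDerHofstad2017, notebook Percolation.nb cell 29] -/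
def hE : Vec := fun b => H3 P 0 b
/-- Cell 30: `B = AiotaNonRep.A + Aiota PS₀ + B2i`. [cite: FitznerVanDerHofstad2017, notebook Percolation.nb cell 30 (transcript l.869–872)] -/
def B : Mat := madd (madd (matMul (AiotaNR P) (A P)) (smul (PS P 0) (Aiota P))) (B2i P)
/-- Cell 30: `Bbar = Aiota.ANonRep + Aiota + Bbar2i` (`ANonRep = A` as coded, D16). [cite: FitznerVanDerHofstad2017, notebook Percolation.nb cell 30 (transcript l.869–872)] -/
def Bbar : Mat := madd (madd (matMul (Aiota P) (A P)) (Aiota P)) (Bbar2i P)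
/-- Cell 31: `C1 = (2 H2.A + 2 AiotaNonRep.H1 + H2).Aiota + H2.Bbar2i`. [cite: FitznerVanDerHofstad2017, notebook Percolation.nb cell 31 (transcript l.884–888)] -/
def C1 : Mat :=
  madd (matMul (madd (madd (smul 2 (matMul (H2 P) (A P))) (smul 2 (matMul (AiotaNR P) (H1 P)))) (H2 P)) (Aiota P))
    (matMul (H2 P) (Bbar2i P))
/-- Cell 31: `C2 = (2 H3.A + 2 AiotaNonRep.H1 + H3).Aiota + 2 C3 + H3.Bbar2i`. [cite: FitznerVanDerHofstad2017, notebook Percolation.nb cell 31 (transcript l.884–888)] -/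
def C2 : Mat :=
  madd (madd (matMul (madd (madd (smul 2 (matMul (H3 P) (A P))) (smul 2 (matMul (AiotaNR P) (H1 P)))) (H3 P)) (Aiota P))
    (smul 2 (C3 P))) (matMul (H3 P) (Bbar2i P))
/-- Cell 40: `B − Aiota` in reduced form (M6a): `AiotaNonRep.A + ½B₂ Aiota + B2i` (`PS₀ = 1 + ½B₂`). [cite: FitznerVanDerHofstad2017, notebook Percolation.nb cell 40 (transcript l.1109–1113)] -/
def BminusAiota : Mat := madd (madd (matMul (AiotaNR P) (A P)) (smul (bubble P 2 0 /ₙ 2) (Aiota P))) (B2i P)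
/-- Cell 40: `C1 − H2.Aiota` in reduced form (M6a): `(2 H2.A + 2 AiotaNonRep.H1).Aiota + H2.Bbar2i`. [cite: FitznerVanDerHofstad2017, notebook Percolation.nb cell 40 (transcript l.1109–1113)] -/
def C1minusH2Aiota : Mat :=
  madd (matMul (madd (smul 2 (matMul (H2 P) (A P))) (smul 2 (matMul (AiotaNR P) (H1 P)))) (Aiota P))
    (matMul (H2 P) (Bbar2i P))

/-! ## Cells 33–35: `N = 0, 1` -/

/-- `Min[1, mubOverMu (d−1)/d]` (cell 33). [cite: FitznerVanDerHofstad2017, notebook Percolation.nb cell 33] -/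
def capMub : T := min 1 (mubOverMu * C (P.d - 1) /ₙ P.d)
/-- Cell 33: `Bound[Xi,0,s] = ½B₂`. [cite: FitznerVanDerHofstad2017, notebook Percolation.nb cell 33 (transcript l.934–945)] -/
def Xi0 : T := bubble P 2 0 /ₙ 2
/-- Cell 33: `Bound[Xi,0,Delta,s] = ½WB₁`. [cite: FitznerVanDerHofstad2017, notebook Percolation.nb cell 33] -/
def Xi0D : T := wb1 P 0 /ₙ 2
/-- Cell 33: `Bound[Xi,R,0,s] = ½B₄`. [cite: FitznerVanDerHofstad2017, notebook Percolation.nb cell 33] -/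
def XiR0 : T := bubble P 4 0 /ₙ 2
/-- Cell 33: `Bound[Xi,R,0,Delta,s] = ½WB₂`. [cite: FitznerVanDerHofstad2017, notebook Percolation.nb cell 33] -/
def XiR0D : T := wb2 P 0 /ₙ 2
/-- Cell 33: `Bound[Psi,RII,0,s] = ½ Min[1, mubOverMu(d−1)/d] B₄`.
[cite: FitznerVanDerHofstad2017, notebook Percolation.nb cell 33] -/
def PsiRII0 : T := capMub P * bubble P 4 0 /ₙ 2
/-- Cell 33: `Bound[Psi,RII,0,Delta,s] = ½ Min[1, mubOverMu(d−1)/d] WB₂`.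
[cite: FitznerVanDerHofstad2017, notebook Percolation.nb cell 33] -/
def PsiRII0D : T := capMub P * wb2 P 0 /ₙ 2
/-- Cell 33: `Bound[Psi,RI,0,s] = (2d−2) z G₁₃ + ½ Min[1, mubOverMu(d−1)/d] B₄`.
[cite: FitznerVanDerHofstad2017, notebook Percolation.nb cell 33] -/
def PsiRI0 : T := C (2 * P.d - 2) * z * G13 P + capMub P * bubble P 4 0 /ₙ 2
/-- Cell 33: `Bound[Psi,RI,0,Delta,s] = mubOverMu/2 (B₂ + WB₁)`.
[cite: FitznerVanDerHofstad2017, notebook Percolation.nb cell 33] -/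
def PsiRI0D : T := mubOverMu /ₙ 2 * (bubble P 2 0 + wb1 P 0)
/-- Cell 34: `Bound[XiIota,0,s] = G₁₃ (1 + ½B₂)`. [cite: FitznerVanDerHofstad2017, notebook Percolation.nb cell 34 (transcript l.951–969)] -/
def XiIota0 : T := G13 P * (1 + bubble P 2 0 /ₙ 2)
/-- Cell 34: `Bound[XiIota,0,Delta,ei,s] = ½ G₁₃ WB₁`.
[cite: FitznerVanDerHofstad2017, notebook Percolation.nb cell 34] -/
def XiIota0Dei : T := G13 P * wb1 P 0 /ₙ 2
/-- Cell 34: `Bound[XiIota,0,Delta,0,s] = G₁₃ ((1 + ½B₂) + ½WB₁)`.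
[cite: FitznerVanDerHofstad2017, notebook Percolation.nb cell 34] -/
def XiIota0D0 : T := G13 P * (1 + bubble P 2 0 /ₙ 2 + wb1 P 0 /ₙ 2)
/-- Cell 34: `Bound[XiIota,alphaI,0,Atei,s] = G₁₃`.
[cite: FitznerVanDerHofstad2017, notebook Percolation.nb cell 34] -/
def XiIotaAlphaI0 : T := G13 P
/-- Cell 34: `Bound[XiIota,alphaII,0,AtZero,s] = 0`.
[cite: FitznerVanDerHofstad2017, notebook Percolation.nb cell 34] -/
def XiIotaAlphaII0 : T := 0
/-- Cell 34: `Bound[XiIota,alphaI,SumAroundei,s] = G₁₃² (2d−1) z`.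
[cite: FitznerVanDerHofstad2017, notebook Percolation.nb cell 34] -/
def XiIotaAlphaISum : T := G13 P ^ 2 * C (2 * P.d - 1) * z
/-- Cell 34: `Bound[XiIota,alphaII,SumAroundZero,s] = G₁₃`.
[cite: FitznerVanDerHofstad2017, notebook Percolation.nb cell 34] -/
def XiIotaAlphaIISum : T := G13 P
/-- Cell 34: `Bound[XiIota,RI,0,s] = ½ G₁₃ B₄`. [cite: FitznerVanDerHofstad2017, notebook Percolation.nb cell 34] -/
def XiIotaRI0 : T := G13 P * bubble P 4 0 /ₙ 2
/-- Cell 34: `Bound[XiIota,RI,0,Delta,ei,s] = ½ G₁₃ WB₂`.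
[cite: FitznerVanDerHofstad2017, notebook Percolation.nb cell 34] -/
def XiIotaRI0Dei : T := G13 P * wb2 P 0 /ₙ 2
/-- Cell 34: `Bound[XiIota,RII,0,s] = ½ G₁₃ B₂`. [cite: FitznerVanDerHofstad2017, notebook Percolation.nb cell 34] -/
def XiIotaRII0 : T := G13 P * bubble P 2 0 /ₙ 2
/-- Cell 34: `Bound[XiIota,RII,0,Delta,0,s] = G₁₃/2 (B₂ + WB₁)`.
[cite: FitznerVanDerHofstad2017, notebook Percolation.nb cell 34] -/
def XiIotaRII0D0 : T := G13 P /ₙ 2 * (bubble P 2 0 + wb1 P 0)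
/-- Cell 34: `Bound[Pi,alpha,0,s] = (2d−2) z G₁₃`.
[cite: FitznerVanDerHofstad2017, notebook Percolation.nb cell 34] -/
def PiAlpha0 : T := C (2 * P.d - 2) * z * G13 P
/-- Cell 34: `Bound[Pi,R,0,s] = 2d² z G₁₃ B₂`. [cite: FitznerVanDerHofstad2017, notebook Percolation.nb cell 34] -/
def PiR0 : T := C (2 * P.d ^ 2) * z * G13 P * bubble P 2 0
/-- Cell 34: `Bound[Pi,R,0,Delta,s] = 2d² z G₁₃ (B₂ + WB₁)`.
[cite: FitznerVanDerHofstad2017, notebook Percolation.nb cell 34] -/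
def PiR0D : T := C (2 * P.d ^ 2) * z * G13 P * (bubble P 2 0 + wb1 P 0)

/-- Cell 35: `Bound[Xi,1,s] = PS.AiotaBar.PE`. [cite: FitznerVanDerHofstad2017, notebook Percolation.nb cell 35 (transcript l.980–1004)] -/
def Xi1 : T := dot (vecMul (PS P) (AiotaBar P)) (PE P)
/-- Cell 35: `PS.AiotaBar.PE − AiotaBar₀₀` in reduced form (M6a): `(AiotaBar.PENT)₀ + (PSNT.AiotaBar)₀ + PSNT.AiotaBar.PENT`.
[cite: FitznerVanDerHofstad2017, notebook Percolation.nb cell 35] -/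
def Xi1red : T :=
  mulVec (AiotaBar P) (PENT P) 0 + vecMul (PSNT P) (AiotaBar P) 0 + dot (vecMul (PSNT P) (AiotaBar P)) (PENT P)
/-- Cell 35: `Bound[Xi,R,1,s] = PS.AiotaBar.PE − AiotaBar₀₀ + B₄`.
[cite: FitznerVanDerHofstad2017, notebook Percolation.nb cell 35] -/
def XiR1 : T := Xi1red P + bubble P 4 0
/-- Cell 35: `Bound[Psi,RI,1,s] = ((2d−1)/(2d)) mubOverMu (PS.AiotaBar.PE − AiotaBar₀₀ + (2d−2) z G₁₃ + B₄)`.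
[cite: FitznerVanDerHofstad2017, notebook Percolation.nb cell 35] -/
def PsiRI1 : T :=
  C (2 * P.d - 1) * mubOverMu * (Xi1red P + C (2 * P.d - 2) * z * G13 P + bubble P 4 0) /ₙ (2 * P.d)
/-- Cell 35: `Bound[Psi,RII,1,s] = ((2d−1)/(2d)) mubOverMu (PS.AiotaBar.PE − AiotaBar₀₀ + B₄)`.
[cite: FitznerVanDerHofstad2017, notebook Percolation.nb cell 35] -/
def PsiRII1 : T := C (2 * P.d - 1) * mubOverMu * (Xi1red P + bubble P 4 0) /ₙ (2 * P.d)
/-- Cell 35: `betatmp`. [cite: FitznerVanDerHofstad2017, notebook Percolation.nb cell 35 (transcript l.980–1004)] -/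
def betatmp : T :=
  H3 P 0 0 + C 2 * (bubble P 2 0 /ₙ 2 * wb2 P 0 + wb1 P 0 /ₙ 2 * bubble P 3 0) + bubble P 2 0 /ₙ 2 * wob P 2 0
    + C 4 * wb3 P 1 * bubble P 3 0 + C 4 * wob P 2 1 * bubble P 4 0 + C 4 * wob P 2 0 * triangle P 4 0
    + C 4 * wob P 1 0 * triangle P 5 0
    + C 3 * dot (vecMul (hS P) (tr (Aiota P))) (PENT P) + C 3 * dot (vecMul (PSNT P) (H3 P)) (PENT P)
    + C 3 * dot (vecMul (PSNT P) (Aiota P)) (hE P)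
/-- Cell 35: `Bound[Xi,1,Delta,s] = betatmp`. [cite: FitznerVanDerHofstad2017, notebook Percolation.nb cell 35] -/
def Xi1D : T := betatmp P
/-- Cell 35: `Bound[Xi,R,1,Delta,s] = betatmp − H2₀₀ + WB₂ = betatmp` (exact cancellation `H2₀₀ = WB₂`, M6a).
[cite: FitznerVanDerHofstad2017, notebook Percolation.nb cell 35] -/
def XiR1D : T := betatmp P
/-- Cell 35: `Bound[Psi,RI,1,Delta,s] = mubOverMu (betatmp + Xi₁)`.
[cite: FitznerVanDerHofstad2017, notebook Percolation.nb cell 35] -/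
def PsiRI1D : T := mubOverMu * (betatmp P + Xi1 P)
/-- Cell 35: `Bound[Psi,RII,1,Delta,s] = mubOverMu (betatmp − H2₀₀ + WB₂) = mubOverMu betatmp`.
[cite: FitznerVanDerHofstad2017, notebook Percolation.nb cell 35] -/
def PsiRII1D : T := mubOverMu * betatmp P
/-- Cell 35: `Bound[XiIota,1,s] = Piota.AiotaBar.PE`.
[cite: FitznerVanDerHofstad2017, notebook Percolation.nb cell 35] -/
def XiIota1 : T := dot (vecMul (Piota P) (AiotaBar P)) (PE P)
/-- Cell 35: `Bound[XiIota,1,Delta,ei,s] = hi₀ + 2 hi.PENT + 2 (Piota.Aiota).hE − hi₀ PENT₀ − (Piota.Aiota)₀ hE₀` in reduced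
form (M6a): `hi₀ + hi₀ PENT₀ + 2 Σ_{b≥1} hi_b PENT_b + (Piota.Aiota)₀ hE₀ + 2 Σ_{b≥1} (Piota.Aiota)_b hE_b`.
[cite: FitznerVanDerHofstad2017, notebook Percolation.nb cell 35] -/
def XiIota1Dei : T :=
  hi P 0 + hi P 0 * PENT P 0 + C 2 * (hi P 1 * PENT P 1 + hi P 2 * PENT P 2)
    + vecMul (Piota P) (Aiota P) 0 * hE P 0
    + C 2 * (vecMul (Piota P) (Aiota P) 1 * hE P 1 + vecMul (Piota P) (Aiota P) 2 * hE P 2)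
/-- Cell 35: `Bound[XiIota,1,Delta,0,s] = 2 XiIota₁Δei + 2 XiIota₁`.
[cite: FitznerVanDerHofstad2017, notebook Percolation.nb cell 35] -/
def XiIota1D0 : T := C 2 * XiIota1Dei P + C 2 * XiIota1 P

/-! ## Cells 36–37: the increasing pieces (the decreasing LOWER bounds are assembled in `Stage1Frame.lean`) -/

/-- `theta2 = Max[Bound[G,ik,2,s], Bound[G,twoi,2,s]]` (cell 36). [cite: FitznerVanDerHofstad2017, notebook Percolation.nb cell 36 (transcript l.1013–1026)] -/
def theta2 : T := max (Gik2 P) (Gtwoi2 P)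
/-- `theta4 = Max[Bound[G,ik,4,s], Bound[G,twoi,4,s]]` (cell 36).
[cite: FitznerVanDerHofstad2017, notebook Percolation.nb cell 36] -/
def theta4 : T := max (Gik4 P) (Gtwoi4 P)
/-- `vartheta = d²/((d−1)(d−2)) (2dz)^5 VarGamma2 Ivalue[1,8,{0}]` (cell 36).
[cite: FitznerVanDerHofstad2017, notebook Percolation.nb cell 36] -/
def vartheta : T := C (P.d ^ 2) * w P ^ 5 * Vg * tab (.I 1 8 .v0) /ₙ ((P.d - 1) * (P.d - 2))
/-- Cell 36, `Bound[Pi,alpha,lower,0,s]`: the subtracted increasing part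
`(2d−2)² z⁴ G₁₃² + (2d−2) z⁴ (Gtwoi₂ + (4d−5) Gik₂ + (4d−4) z³ + 2d ϑ)`.
[cite: FitznerVanDerHofstad2017, notebook Percolation.nb cell 36] -/
def piAlphaLowSub : T :=
  C ((2 * P.d - 2) ^ 2) * z ^ 4 * G13 P ^ 2
    + C (2 * P.d - 2) * z ^ 4 * (Gtwoi2 P + C (4 * P.d - 5) * Gik2 P + C (4 * P.d - 4) * z ^ 3 + C (2 * P.d) * vartheta P)
/-- Cell 36: the bracket argument `G₁₃ + Gik₂ + 3 Gmax₁` of `Bound[Pi,alpha,lower,0,s]`.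
[cite: FitznerVanDerHofstad2017, notebook Percolation.nb cell 36] -/
def piAlphaLowBr : T := G13 P + Gik2 P + C 3 * Gmax1 P
/-- Cell 36, `Bound[Psi,lower,0,s]`: bracket argument `G₁₃ + 2θ₂ + 2z`.
[cite: FitznerVanDerHofstad2017, notebook Percolation.nb cell 36] -/
def psiLowBr1 : T := G13 P + C 2 * theta2 P + C 2 * z
/-- Cell 36, `Bound[Psi,lower,0,s]`: bracket argument `2z² + G₁₃ + 2θ₂ + 2ϑ + (d/(d−1)) (2dz)^5 VarGamma2 K[1,6,{0,1}]`.
[cite: FitznerVanDerHofstad2017, notebook Percolation.nb cell 36] -/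
def psiLowBr2 : T :=
  C 2 * z ^ 2 + G13 P + C 2 * theta2 P + C 2 * vartheta P + C P.d * w P ^ 5 * Vg * tab (.K 1 6 .v01) /ₙ (P.d - 1)
/-- Cell 36, `Bound[Pi,1,Lower,s]`: bracket argument `z + 3G₁₃ + θ₂ + θ₄` (first term).
[cite: FitznerVanDerHofstad2017, notebook Percolation.nb cell 36] -/
def pi1Br0 : T := z + C 3 * G13 P + theta2 P + theta4 P
/-- Cell 36, `Bound[Pi,1,Lower,s]`: `θ₄ + ϑ` (second term).
[cite: FitznerVanDerHofstad2017, notebook Percolation.nb cell 36] -/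
def pi1T2 : T := theta4 P + vartheta P
/-- bracket argument `z + z² + 2G₁₃ + 2θ₄ + ϑ` (cell 36, fourth term).
[cite: FitznerVanDerHofstad2017, notebook Percolation.nb cell 36] -/
def pi1Br4a : T := z + z ^ 2 + C 2 * G13 P + C 2 * theta4 P + vartheta P
/-- bracket argument `z + 2z² + 2z³ + 2G₁₃ + 4θ₄ + 2ϑ` = `pi1Br4a + (z² + 2z³ + 2θ₄ + ϑ)` (cell 36, third term).
[cite: FitznerVanDerHofstad2017, notebook Percolation.nb cell 36] -/
def pi1Br3a : T := pi1Br4a P + (z ^ 2 + C 2 * z ^ 3 + C 2 * theta4 P + vartheta P)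
/-- bracket argument `G₁₃ + θ₂` (cell 36, fourth term).
[cite: FitznerVanDerHofstad2017, notebook Percolation.nb cell 36] -/
def pi1Br4b : T := G13 P + theta2 P
/-- bracket argument `G₁₃ + θ₂ + ϑ` = `pi1Br4b + ϑ` (cell 36, third term).
[cite: FitznerVanDerHofstad2017, notebook Percolation.nb cell 36] -/
def pi1Br3b : T := pi1Br4b P + vartheta P
/-- bracket argument `z + 2z² + 2G₁₃ + 4θ₄ + 3ϑ + (2dz)⁴ VarGamma2 Ivalue[1,8,{0}]` = `pi1Br4a + (…)` (cell 36, fifth term).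
[cite: FitznerVanDerHofstad2017, notebook Percolation.nb cell 36] -/
def pi1Br5a : T := pi1Br4a P + (z ^ 2 + C 2 * theta4 P + C 2 * vartheta P + w P ^ 4 * Vg * tab (.I 1 8 .v0))
/-- bracket argument `2G₁₃ + θ₂ + ϑ` = `pi1Br3b + G₁₃` (cell 36, fifth term).
[cite: FitznerVanDerHofstad2017, notebook Percolation.nb cell 36] -/
def pi1Br5b : T := pi1Br3b P + G13 P
/-- Cell 37: `Bound[Xi,alpha,1-0,AtEi,s] = (2d−2) z⁴ (1 − (1−z³)^{2d−3}) + z² ((2d−2) Gik₄ + Gtwoi₄)` (`2d−3 = 2(d−2)+1`).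
[cite: FitznerVanDerHofstad2017, notebook Percolation.nb cell 37 (transcript l.1035–1055)] -/
def XiAlpha10 : T := C (2 * P.d - 2) * z ^ 4 * oddComp (z ^ 3) (P.d - 2) + z ^ 2 * (C (2 * P.d - 2) * Gik4 P + Gtwoi4 P)
/-- Cell 37: `Bound[Xi,alpha,0-1,AtEi,s] = z G₁₅ + (2d−2) z⁵ + 4(d−1) z⁴ (G₁₃ + Gik₄)`.
[cite: FitznerVanDerHofstad2017, notebook Percolation.nb cell 37] -/
def XiAlpha01 : T := z * G1 P 5 + C (2 * P.d - 2) * z ^ 5 + C (4 * (P.d - 1)) * z ^ 4 * (G13 P + Gik4 P)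
/-- Cell 37: `Bound[Psi,alphaI,1-0,AroundEi,s]`. [cite: FitznerVanDerHofstad2017, notebook Percolation.nb cell 37] -/
def PsiAlphaI10 : T :=
  mubOverMu * z ^ 2 * (C (2 * P.d - 2) * z ^ 2 + C (4 * (P.d - 1)) * Gik4 P + Gtwoi2 P)
    + C (2 * P.d - 2) * mubOverMu * z ^ 4 * (G13 P + Gik2 P + Gtwoi2 P + C P.d * w P ^ 5 * Vg * tab (.K 1 6 .v01) /ₙ (P.d - 1))
/-- Cell 37, `Bound[Psi,alphaI,0-1,AroundEi,s]`: the increasing first part `mubOverMu z² ((2d−2)z² + 4(d−1)Gik₄ + Gtwoi₂ + (4d−3)G₁₃²)`.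
[cite: FitznerVanDerHofstad2017, notebook Percolation.nb cell 37] -/
def PsiAlphaI01main : T :=
  mubOverMu * z ^ 2 * (C (2 * P.d - 2) * z ^ 2 + C (4 * (P.d - 1)) * Gik4 P + Gtwoi2 P + C (4 * P.d - 3) * G13 P ^ 2)
/-- … its coefficient `(2d−2) mubOverMu[i] z[i]⁴` (a constant term). [folklore] -/
def PsiAlphaI01coef : T := C (2 * P.d - 2) * atom .mubOverMuI * zI P ^ 4
/-- … and the two bracket arguments `2G₁₃[s] + Gik₂[s]`, `G₁₃[o] + θ₂[s]` of `1 − 2(1 − ·)(1 − ·)`. [folklore] -/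
def PsiAlphaI01brA : T := C 2 * G13 P + Gik2 P
/-- … the second bracket argument `G₁₃[o] + θ₂[s]` of `Bound[Psi,alphaI,0-1,AroundEi,s]`. [cite: FitznerVanDerHofstad2017, notebook Percolation.nb cell 37 (transcript l.1035–1055)] -/
def PsiAlphaI01brB : T := atom (.G13at .o) + theta2 P
/-- Cell 37: `Bound[Psi,alphaII,1-0,AroundZero,s]`.
[cite: FitznerVanDerHofstad2017, notebook Percolation.nb cell 37] -/
def PsiAlphaII10 : T :=
  C ((2 * P.d - 1) * (2 * P.d - 2)) * mubOverMu * z ^ 4 * oddComp (z ^ 3) (P.d - 2)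
    + C (2 * P.d - 1) * mubOverMu * z ^ 2 * (C (2 * P.d - 2) * Gik4 P + Gtwoi4 P)
    + C ((2 * P.d - 2) ^ 2) * z ^ 4 * G13 P ^ 2
    + C (2 * P.d - 2) * z ^ 4 * (Gtwoi4 P + C (4 * P.d - 5) * Gik2 P + C (4 * P.d - 4) * z ^ 3 + C (2 * P.d) * vartheta P)
/-- Cell 37, `Bound[Psi,alphaII,0-1,AroundZero,s]`: first part `(2d−1) z G₁₅`, coefficient `(2d−1)(2d−2) z⁴ mubOverMu`, and
the bracket arguments `z + 2G₁₃[o] + 2θ₄`, `G₁₃[o] + θ₂ + ϑ` of `1 − (1 − ·)(1 − ·)`.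
[cite: FitznerVanDerHofstad2017, notebook Percolation.nb cell 37] -/
def PsiAlphaII01main : T := C (2 * P.d - 1) * z * G1 P 5
/-- … its coefficient `(2d−1)(2d−2) z⁴ mubOverMu[s]`. [cite: FitznerVanDerHofstad2017, notebook Percolation.nb cell 37 (transcript l.1035–1055)] -/
def PsiAlphaII01coef : T := C ((2 * P.d - 1) * (2 * P.d - 2)) * z ^ 4 * mubOverMu
/-- … its first bracket argument `z + 2G₁₃[o] + 2θ₄`. [cite: FitznerVanDerHofstad2017, notebook Percolation.nb cell 37 (transcript l.1035–1055)] -/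
def PsiAlphaII01brA : T := z + C 2 * atom (.G13at .o) + C 2 * theta4 P
/-- … its second bracket argument `G₁₃[o] + θ₂ + ϑ`. [cite: FitznerVanDerHofstad2017, notebook Percolation.nb cell 37 (transcript l.1035–1055)] -/
def PsiAlphaII01brB : T := PsiAlphaI01brB P + vartheta P

/-! ## Cells 38–40: `N = 2, 3` (the `EvenTail`/`OddTail` cells 41–42 are replaced by these first terms, `T″₀`) -/

/-- Cell 38: `Bound[Xi,2,s] = PS.B.AiotaBar.PE`. [cite: FitznerVanDerHofstad2017, notebook Percolation.nb cell 38 (transcript l.1067–1084)] -/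
def Xi2 : T := dot (vecMul (vecMul (PS P) (B P)) (AiotaBar P)) (PE P)
/-- Cell 38: `Bound[XiIota,2,s] = Piota.B.AiotaBar.PE`.
[cite: FitznerVanDerHofstad2017, notebook Percolation.nb cell 38] -/
def XiIota2 : T := dot (vecMul (vecMul (Piota P) (B P)) (AiotaBar P)) (PE P)
/-- Cell 38: `Bound[Xi,3,s] = PS.B.B.AiotaBar.PE`.
[cite: FitznerVanDerHofstad2017, notebook Percolation.nb cell 38] -/
def Xi3 : T := dot (vecMul (vecMul (vecMul (PS P) (B P)) (B P)) (AiotaBar P)) (PE P)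
/-- Cell 38: `Bound[XiIota,3,s] = Piota.B.B.AiotaBar.PE`.
[cite: FitznerVanDerHofstad2017, notebook Percolation.nb cell 38] -/
def XiIota3 : T := dot (vecMul (vecMul (vecMul (Piota P) (B P)) (B P)) (AiotaBar P)) (PE P)
/-- `C1.Bbar + B.C2` (cells 38, 40). [cite: FitznerVanDerHofstad2017, notebook Percolation.nb cell 38] -/
def C1BbarBC2 : Mat := madd (matMul (C1 P) (Bbar P)) (matMul (B P) (C2 P))
/-- `H2.PENT + Aiota.hE` (cells 38, 40). [cite: FitznerVanDerHofstad2017, notebook Percolation.nb cell 38] -/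
def H2PENTAhE : Vec := vadd (mulVec (H2 P) (PENT P)) (mulVec (Aiota P) (hE P))
/-- `hS.Transpose[Aiota]` (cells 38, 40). [cite: FitznerVanDerHofstad2017, notebook Percolation.nb cell 38] -/
def hSAt : Vec := vecMul (hS P) (tr (Aiota P))
/-- Cell 38: `Bound[Xi,3,Delta,s]`. [cite: FitznerVanDerHofstad2017, notebook Percolation.nb cell 38] -/
def Xi3D : T :=
  C 3 * (dot (vecMul (vecMul (vecMul e0 (B P)) (B P)) (H3 P)) e0
          + dot (vecMul e0 (madd (matMul (B P) (C1 P)) (matMul (C2 P) (Bbar P)))) e0)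
    + C 4 * (dot (vecMul (vecMul e0 (B P)) (B P)) (H2PENTAhE P) + dot (vecMul e0 (C1BbarBC2 P)) (PENT P))
    + C 4 * (dot (vecMul (vecMul (hSAt P) (Bbar P)) (Bbar P)) e0 + dot (vecMul (vecMul (PSNT P) (B P)) (B P)) (mulVec (H2 P) e0)
          + dot (vecMul (PSNT P) (C1BbarBC2 P)) e0)
    + C 5 * (dot (vecMul (vecMul (hSAt P) (Bbar P)) (Bbar P)) (PENT P)
          + dot (vecMul (vecMul (PSNT P) (B P)) (B P)) (H2PENTAhE P) + dot (vecMul (PSNT P) (C1BbarBC2 P)) (PENT P))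
/-- Cell 38: `Bound[XiIota,2,Delta,ei,s]`. [cite: FitznerVanDerHofstad2017, notebook Percolation.nb cell 38] -/
def XiIota2Dei : T :=
  C 2 * (dot (vecMul (hII P) (Bbar P)) e0 + dot (vecMul (vecMul (Piota P) (B P)) (H3 P)) e0)
    + C 3 * (dot (vecMul (hII P) (Bbar P)) (PENT P)
          + dot (vecMul (Piota P) (B P)) (vadd (mulVec (H3 P) (PENT P)) (mulVec (Aiota P) (hE P))))
/-- Cell 38: `Bound[XiIota,3,Delta,ei,s]`. [cite: FitznerVanDerHofstad2017, notebook Percolation.nb cell 38] -/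
def XiIota3Dei : T :=
  C 3 * (dot (vecMul (vecMul (hII P) (Bbar P)) (Bbar P)) e0 + dot (vecMul (vecMul (vecMul (Piota P) (B P)) (B P)) (H2 P)) e0)
    + C 3 * dot (vecMul (vecMul (Piota P) (B P)) (C2 P)) e0
    + C 4 * (dot (vecMul (vecMul (hII P) (Bbar P)) (Bbar P)) (PENT P)
          + dot (vecMul (vecMul (Piota P) (B P)) (B P)) (H2PENTAhE P))
    + C 4 * dot (vecMul (vecMul (Piota P) (B P)) (C2 P)) (PENT P)
/-- Cell 38: `Bound[XiIota,2,Delta,0,s]` (NB `Transpose[Aiota].hE` in the last term, as coded).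
[cite: FitznerVanDerHofstad2017, notebook Percolation.nb cell 38] -/
def XiIota2D0 : T :=
  C 3 * dot (vecMul (vecMul (Piota P) (B P)) (AiotaBar P)) e0 + C 4 * dot (vecMul (vecMul (Piota P) (B P)) (AiotaBar P)) (PENT P)
    + C 3 * (dot (vecMul (hII P) (Bbar P)) e0 + dot (vecMul (vecMul (Piota P) (B P)) (H3 P)) e0)
    + C 4 * (dot (vecMul (hII P) (Bbar P)) (PENT P)
          + dot (vecMul (Piota P) (B P)) (vadd (mulVec (H3 P) (PENT P)) (mulVec (tr (Aiota P)) (hE P))))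
/-- Cell 38: `Bound[XiIota,3,Delta,0,s]`. [cite: FitznerVanDerHofstad2017, notebook Percolation.nb cell 38] -/
def XiIota3D0 : T :=
  C 4 * dot (vecMul (vecMul (vecMul (Piota P) (B P)) (B P)) (AiotaBar P)) e0
    + C 5 * dot (vecMul (vecMul (vecMul (Piota P) (B P)) (B P)) (AiotaBar P)) (PENT P)
    + C 4 * (dot (vecMul (vecMul (hII P) (Bbar P)) (Bbar P)) e0 + dot (vecMul (vecMul (vecMul (Piota P) (B P)) (B P)) (H2 P)) e0)
    + C 4 * dot (vecMul (vecMul (Piota P) (B P)) (C2 P)) e0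
    + C 5 * (dot (vecMul (vecMul (hII P) (Bbar P)) (Bbar P)) (PENT P)
          + dot (vecMul (vecMul (Piota P) (B P)) (B P)) (H2PENTAhE P))
    + C 5 * dot (vecMul (vecMul (Piota P) (B P)) (C2 P)) (PENT P)
/-- Cell 39: `Bound[Hdash,AtZero,1,s] = (WB₁ + WOB₁ B₂)/(1 − OpenBubble₁)` — the inverse is the derived atom `hdInv` (M6c).
[cite: FitznerVanDerHofstad2017, notebook Percolation.nb cell 39 (transcript l.1098–1106)] -/
def HdashA1 : T := wb1 P 0 * atom .hdInv + wob P 1 0 * bubble P 2 0 * atom .hdInv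
/-- Cell 39: `Bound[Hdash,AtZero,2,s]/(2dz)^k = WB₂/(2dz)^k + Hdash_{AtZero,1} OpenBubble₂/(2dz)^k + B₂ WOB₂/(2dz)^k`.
[cite: FitznerVanDerHofstad2017, notebook Percolation.nb cell 39] -/
def HdashA2 (k : ℕ) : T := wb2 P k + HdashA1 P * openBubble P 2 k + bubble P 2 0 * wob P 2 k
/-- Cell 39: `Bound[Hdash,NotZero,l,s] = WOB_l + Hdash_{AtZero,1} OpenBubble_l + B₂ WOB_l`, `l = 1, 2`.
[cite: FitznerVanDerHofstad2017, notebook Percolation.nb cell 39] -/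
def HdashN (l : ℕ) : T := wob P l 0 + HdashA1 P * openBubble P l 0 + bubble P 2 0 * wob P l 0
/-- Cell 40: `Bound[Xi,2,Delta,s]` with `B − Aiota`, `C1 − H2.Aiota` in reduced form (M6a). [cite: FitznerVanDerHofstad2017, notebook Percolation.nb cell 40 (transcript l.1109–1113)] -/
def Xi2D : T :=
  C 2 * (dot (vecMul (vecMul e0 (BminusAiota P)) (H3 P)) e0 + dot (vecMul e0 (C1minusH2Aiota P)) e0)
    + (bubble P 3 0 * HdashN P 1 + bubble P 3 1 * HdashN P 2 + C 2 * bubble P 3 0 * wb2 P 0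
        + C 2 * wb3 P 1 * bubble P 4 0 + C 2 * HdashA2 P 1 * bubble P 4 0 + C 2 * wob P 2 0 * triangle P 5 0
        + C 2 * HdashN P 1 * triangle P 5 0)
    + C 6 * (dot (vecMul (hSAt P) (Bbar P)) e0 + dot (vecMul (vecMul (PSNT P) (B P)) (H3 P)) e0
          + dot (vecMul (PSNT P) (C1 P)) e0)
    + C 4 * (dot (vecMul (hSAt P) (Bbar P)) (PENT P)
          + dot (vecMul (PSNT P) (B P)) (vadd (mulVec (H3 P) (PENT P)) (mulVec (Aiota P) (hE P)))
          + dot (vecMul (PSNT P) (C1 P)) (PENT P))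

/-! ## Cell 43: the aggregates (with `EvenTail := Bound[·,2,·]`, `OddTail := Bound[·,3,·]`, variant `T″₀`) -/

/-- Cell 43 (`T″₀`): `Bound[Xi,Even,s] = Xi₀ + Xi₂`. [cite: FitznerVanDerHofstad2017, notebook Percolation.nb cell 43 (transcript l.1182–1202)] -/
def XiEven : T := Xi0 P + Xi2 P
/-- Cell 43 (`T″₀`): `Bound[Xi,Odd,s] = Xi₁ + Xi₃`.
[cite: FitznerVanDerHofstad2017, notebook Percolation.nb cell 43] -/
def XiOdd : T := Xi1 P + Xi3 P
/-- Cell 43: `Bound[Xi,Absolut,s] = Odd + Even`. [cite: FitznerVanDerHofstad2017, notebook Percolation.nb cell 43] -/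
def XiAbs : T := XiOdd P + XiEven P
/-- Cell 43 (`T″₀`): `Bound[Xi,Even,Delta,s] = Xi₀Δ + Xi₂Δ`.
[cite: FitznerVanDerHofstad2017, notebook Percolation.nb cell 43] -/
def XiEvenD : T := Xi0D P + Xi2D P
/-- Cell 43 (`T″₀`): `Bound[Xi,Odd,Delta,s] = Xi₁Δ + Xi₃Δ`.
[cite: FitznerVanDerHofstad2017, notebook Percolation.nb cell 43] -/
def XiOddD : T := Xi1D P + Xi3D P
/-- Cell 43: `Bound[Xi,Absolut,Delta,s]`. [cite: FitznerVanDerHofstad2017, notebook Percolation.nb cell 43] -/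
def XiAbsD : T := XiOddD P + XiEvenD P
/-- Cell 43 (`T″₀`): `Bound[XiIota,Even,s] = XiIota₀ + XiIota₂`.
[cite: FitznerVanDerHofstad2017, notebook Percolation.nb cell 43] -/
def XiIotaEven : T := XiIota0 P + XiIota2 P
/-- Cell 43 (`T″₀`): `Bound[XiIota,Odd,s] = XiIota₁ + XiIota₃`.
[cite: FitznerVanDerHofstad2017, notebook Percolation.nb cell 43] -/
def XiIotaOdd : T := XiIota1 P + XiIota3 P
/-- Cell 43: `Bound[XiIota,Absolut,s]`. [cite: FitznerVanDerHofstad2017, notebook Percolation.nb cell 43] -/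
def XiIotaAbs : T := XiIotaOdd P + XiIotaEven P
/-- Cell 43 (`T″₀`): `Bound[XiIota,Even,Delta,ei,s]`.
[cite: FitznerVanDerHofstad2017, notebook Percolation.nb cell 43] -/
def XiIotaEvenDei : T := XiIota0Dei P + XiIota2Dei P
/-- Cell 43 (`T″₀`): `Bound[XiIota,Odd,Delta,ei,s]`.
[cite: FitznerVanDerHofstad2017, notebook Percolation.nb cell 43] -/
def XiIotaOddDei : T := XiIota1Dei P + XiIota3Dei P
/-- Cell 43: `Bound[XiIota,Absolut,Delta,ei,s]`. [cite: FitznerVanDerHofstad2017, notebook Percolation.nb cell 43] -/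
def XiIotaAbsDei : T := XiIotaOddDei P + XiIotaEvenDei P
/-- Cell 43 (`T″₀`): `Bound[XiIota,Even,Delta,0,s]`.
[cite: FitznerVanDerHofstad2017, notebook Percolation.nb cell 43] -/
def XiIotaEvenD0 : T := XiIota0D0 P + XiIota2D0 P
/-- Cell 43 (`T″₀`): `Bound[XiIota,Odd,Delta,0,s]`.
[cite: FitznerVanDerHofstad2017, notebook Percolation.nb cell 43] -/
def XiIotaOddD0 : T := XiIota1D0 P + XiIota3D0 P
/-- Cell 43: `Bound[XiIota,Absolut,Delta,0,s]`. [cite: FitznerVanDerHofstad2017, notebook Percolation.nb cell 43] -/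
def XiIotaAbsD0 : T := XiIotaOddD0 P + XiIotaEvenD0 P

end Cells

end Stage1Cells
end Literature.Probability.FitznerVanDerHofstad2017
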